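import Summits.MatrixMultiplication.OmegaCensus.ThreeSetFibreMoment
import Summits.MatrixMultiplication.OmegaCensus.ThreeSetZ5Z5PlaneCertificate
import HarnessLib

/-!
# `𝔽₁₃` test-vector certificates for the fibre-moment system over `ℤ₅ × ℤ₅` (`W = {0, e₁, e₂}`)

ω-census `pub-omega`, family (b3), seat pub-omega-group gen 37.  Framing: lottery ticket; floor = certified bounds/negative
ranges.  VALUE: the kernel check that closes the census cells `(3,3,12)@325` and `(3,4,9)@325` of `ℤ₅ × ℤ₆₅ = ℤ₅² × ℤ₁₃`
(`ThreeSetZ5Z65Cells3x.lean`) once their `ℤ₅²` data are pinned; NOT progress on ω.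

Setting (`ThreeSetFibreMoment.lean`).  With `B = ZMod 5 × ZMod 5`, `R = ZMod 13`, `Wc = 𝟙_T` (`T = {0, e₁, e₂}`), `Xc = gridFn e`,
`Yc = gridFn h` (the pinned fibre counts) the collected fibre-moment identities read, for every `t`,
`Σ_v Ws v·α(t,v) + Σ_r Xs r·β(t,r) + Σ_u Ys u·γ(t,u) + [t = (2,2)]·s₀ = 0`, where the unknowns are the fibre sums `Ws, Xs, Ys`
of a projection `Ψ : A →+ ZMod 13` and `s₀ = Ψ(x₀)`; moreover `Ws` vanishes off `{e₁, e₂}`, `Xs` off the support of `e`, `Ys` off the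
support of `h`.
* `momB_single` — the coefficient `β(t,r)` as a single sum `Σ_v Wc v·(Yc(t+v−r) − Yc(r+t−v) + Yc(r−t+v))`;
* `momentCertOK e h L c₁ c₂` (`Bool`, decided by the kernel per instance): the test vector `λ = L` (read through `ptIdx`) has
  `Σ_t λ_t α(t,e₁) = c₁`, `Σ_t λ_t α(t,e₂) = c₂`, `Σ_t λ_t β(t,r) = 0` on the support of `e`, `Σ_t λ_t γ(t,u) = 0` on the support
  of `h`, and `λ_{(2,2)} = 0`;
* **`lin_comb_Ws_eq_zero`** — then `c₁·Ws(e₁) + c₂·Ws(e₂) = 0` (`FibreMoment.moment_pairing`); with the certificates `(1,0)` and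
  `(0,1)` both fibre sums of `W` vanish.
-/

namespace Summit.MatrixMultiplication.OmegaCensus

namespace Z5Z5ThreeSet

open Finset ZpZpDomino FibreMoment

/-- The indicator list of `T = {(0,0), (1,0), (0,1)}` in the point numbering `5u₁ + u₂`. [folklore] -/
def tlist : List ℕ := [1, 1, 0, 0, 0, 1, 0, 0, 0, 0, 0, 0, 0, 0, 0, 0, 0, 0, 0, 0, 0, 0, 0, 0, 0]

/-- A list of `25` naturals as a `ZMod 13`-valued function on `ZMod 5 × ZMod 5`. [folklore] -/
def zc (F : List ℕ) : ZMod 5 × ZMod 5 → ZMod 13 := fun w => ((gridFn F w : ℕ) : ZMod 13)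

/-- A test vector (list of `25` residues) as a function on `ZMod 5 × ZMod 5`. [folklore] -/
def lamFn (L : List ℕ) : ZMod 5 × ZMod 5 → ZMod 13 := fun t => ((L.getD (ptIdx 5 t) 0 : ℕ) : ZMod 13)

section Algebra

variable {B R : Type*} [AddCommGroup B] [Fintype B] [DecidableEq B] [CommRing R]

/-- The coefficient `β(t,r)` of `FibreMoment.momB` as a single sum:
`β(t,r) = Σ_v Wc v·(Yc(t+v−r) − Yc(r+t−v) + Yc(r−t+v))`. [folklore] -/
theorem momB_single (Wc Yc : B → R) (t r : B) :
    momB Wc Yc t r = ∑ v : B, Wc v * (Yc (t + v - r) - Yc (r + t - v) + Yc (r - t + v)) := by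
  unfold momB
  rw [sum_comm]
  refine sum_congr rfl fun v _ => ?_
  have e : ∀ u : B, Wc v * Yc u *
      ((if t - u + v = r then (1 : R) else 0) - (if v + u - t = r then 1 else 0) + (if t + u - v = r then 1 else 0)) =
      Wc v * (Yc u * (if t + v - r = u then 1 else 0)) - Wc v * (Yc u * (if r + t - v = u then 1 else 0)) +
        Wc v * (Yc u * (if r - t + v = u then 1 else 0)) := by
    intro u
    have i1 : (t - u + v = r) ↔ (t + v - r = u) := by constructor <;> intro h <;> rw [← h] <;> abel
    have i2 : (v + u - t = r) ↔ (r + t - v = u) := by constructor <;> intro h <;> rw [← h] <;> abel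
    have i3 : (t + u - v = r) ↔ (r - t + v = u) := by constructor <;> intro h <;> rw [← h] <;> abel
    simp only [i1, i2, i3]
    ring
  rw [Fintype.sum_congr _ _ e, sum_add_distrib, sum_sub_distrib, ← mul_sum, ← mul_sum, ← mul_sum, sum_mul_ite_eq',
    sum_mul_ite_eq', sum_mul_ite_eq']
  ring

end Algebra

/-- `Σ_t λ_t·α(t,v)` for `Xc = zc e`, `Yc = zc h`. [folklore] -/
def accA (e h L : List ℕ) (v : ZMod 5 × ZMod 5) : ZMod 13 := ∑ t : ZMod 5 × ZMod 5, lamFn L t * momA (zc e) (zc h) t v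

/-- `Σ_t λ_t·β(t,r)` for `Wc = zc tlist`, `Yc = zc h` (single-sum form). [folklore] -/
def accB (h L : List ℕ) (r : ZMod 5 × ZMod 5) : ZMod 13 :=
  ∑ t : ZMod 5 × ZMod 5, lamFn L t * ∑ v : ZMod 5 × ZMod 5, zc tlist v * (zc h (t + v - r) - zc h (r + t - v) + zc h (r - t + v))

/-- `Σ_t λ_t·γ(t,u)` for `Wc = zc tlist`, `Xc = zc e`. [folklore] -/
def accC (e L : List ℕ) (u : ZMod 5 × ZMod 5) : ZMod 13 := ∑ t : ZMod 5 × ZMod 5, lamFn L t * momC (zc tlist) (zc e) t u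

/-- **Moment certificate check** (decided by the kernel per instance): the test vector `L` isolates `c₁·Ws(e₁) + c₂·Ws(e₂)`. [folklore] -/
def momentCertOK (e h L : List ℕ) (c₁ c₂ : ZMod 13) : Bool :=
  decide (accA e h L (1, 0) = c₁ ∧ accA e h L (0, 1) = c₂ ∧ (∀ r : ZMod 5 × ZMod 5, gridFn e r ≠ 0 → accB h L r = 0) ∧
    (∀ u : ZMod 5 × ZMod 5, gridFn h u ≠ 0 → accC e L u = 0) ∧ lamFn L (2, 2) = 0)

/-- **Soundness of the moment certificate**: from the collected fibre-moment identities (right-hand side `0`, hole `(2,2)`) and the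
support conditions, `c₁·Ws(e₁) + c₂·Ws(e₂) = 0`. [folklore] -/
theorem lin_comb_Ws_eq_zero {e h L : List ℕ} {c₁ c₂ : ZMod 13} (hcert : momentCertOK e h L c₁ c₂ = true)
    (Ws Xs Ys : ZMod 5 × ZMod 5 → ZMod 13) (s₀ : ZMod 13)
    (hid : ∀ t : ZMod 5 × ZMod 5, (∑ v, Ws v * momA (zc e) (zc h) t v) + (∑ r, Xs r * momB (zc tlist) (zc h) t r) +
      (∑ u, Ys u * momC (zc tlist) (zc e) t u) + (if ((2, 2) : ZMod 5 × ZMod 5) = t then s₀ else 0) = 0)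
    (hW0 : ∀ v, v ≠ (1, 0) → v ≠ (0, 1) → Ws v = 0) (hX0 : ∀ r, gridFn e r = 0 → Xs r = 0)
    (hY0 : ∀ u, gridFn h u = 0 → Ys u = 0) : c₁ * Ws (1, 0) + c₂ * Ws (0, 1) = 0 := by
  have hc := of_decide_eq_true hcert
  obtain ⟨hA1, hA2, hB, hC, hL⟩ := hc
  have key := moment_pairing (momA (zc e) (zc h)) (momB (zc tlist) (zc h)) (momC (zc tlist) (zc e)) Ws Xs Ys (fun _ => 0)
    (2, 2) s₀ hid (lamFn L)
  simp only [mul_zero, sum_const_zero] at key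
  rw [hL, zero_mul, add_zero] at key
  -- the `Xs` and `Ys` blocks vanish termwise
  have hXblock : (∑ r : ZMod 5 × ZMod 5, Xs r * ∑ t : ZMod 5 × ZMod 5, lamFn L t * momB (zc tlist) (zc h) t r) = 0 := by
    refine sum_eq_zero fun r _ => ?_
    by_cases hr : gridFn e r = 0
    · rw [hX0 r hr, zero_mul]
    · have hb := hB r hr
      unfold accB at hb
      have e1 : (∑ t : ZMod 5 × ZMod 5, lamFn L t * momB (zc tlist) (zc h) t r) = 0 := by
        rw [← hb]; exact sum_congr rfl fun t _ => by rw [momB_single]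
      rw [e1, mul_zero]
  have hYblock : (∑ u : ZMod 5 × ZMod 5, Ys u * ∑ t : ZMod 5 × ZMod 5, lamFn L t * momC (zc tlist) (zc e) t u) = 0 := by
    refine sum_eq_zero fun u _ => ?_
    by_cases hu : gridFn h u = 0
    · rw [hY0 u hu, zero_mul]
    · have hcu := hC u hu
      unfold accC at hcu
      rw [hcu, mul_zero]
  rw [hXblock, hYblock, add_zero, add_zero] at key
  -- the `Ws` block reduces to the two basis points
  have h10 : ((1, 0) : ZMod 5 × ZMod 5) ≠ (0, 1) := by decide
  have hout : ∀ v ∈ (univ : Finset (ZMod 5 × ZMod 5)), v ∉ ({(1, 0), (0, 1)} : Finset (ZMod 5 × ZMod 5)) →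
      Ws v * ∑ t : ZMod 5 × ZMod 5, lamFn L t * momA (zc e) (zc h) t v = 0 := by
    intro v _ hv
    simp only [mem_insert, mem_singleton, not_or] at hv
    rw [hW0 v hv.1 hv.2, zero_mul]
  rw [← sum_subset (subset_univ ({(1, 0), (0, 1)} : Finset (ZMod 5 × ZMod 5))) hout,
    sum_insert (by simpa using h10), sum_singleton] at key
  unfold accA at hA1 hA2
  rw [hA1, hA2] at key
  linear_combination key

end Z5Z5ThreeSet

end Summit.MatrixMultiplication.OmegaCensus
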